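import Mathlib

set_option autoImplicit false
set_option linter.dupNamespace false

/-!
# `EZConstantPadic_g79` — the (eZ) constant in the 7-ADIC currency: anisotropy of `x² + 7y²` over `ℤ₇`,
# the normal form `α₀² + 7α₁² = w·7^{jα}`, the (F-b) kernel `7^j ∣ α₀² + 7α₁² ⟹ π^j ∣ α₀ − α₁π` in any
# `ℤ₇`-algebra with `7 = v·π²`, the D916 divisibility in that currency, and the injectivity of the
# `(ι₇ ⊗ ιC)`-reading of `ℚ₇ ⊗ K` into `ℂ`

Crux workfile `Cruxes/EllipticUnitValueSevenOfGZK/EZConstantPadic_g79.lean` — bsd-idea-20 g79 (planner / ideator seat,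
claim-free, kit 0, W-71, W-79 publish-only: NO `ledger skeleton check` is run on this file).  Companion of
`StarValuePin_g79.md` REV 1.1 §8.2 (hazard (H-γ)) and §9 (3) (repair (ρ1)): the (eZ) constant `α = α₀ + α₁√−7` of
`GenusSeven.KatoExpDatum.val_zStar` is, for a Tate-module Kummer column, a 7-ADIC number (`α₀ α₁ ∈ ℤ₇`, read into `ℂ`
through the datum's `ι₇ : ℚ_[7] →+* ℂ` like the scalars of (e1′)), not a pair of integers.  This file supplies, over
`Mathlib` only, the datum-free algebra the re-typing needs, letter-parallel to the integer kernel of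
`Additive/RamifiedSevenPeriodPositionKernel.lean` §1 (`pow_dvd_intCast_sub_intCast_mul`,
`seven_pow_factorization_dvd_norm`, `pow_dvd_constZ_mul_of_le`, `pow_dvd_constZ_of_le`):

* §1 `normSeven_eq_zero_iff` — `α₀² + 7α₁² = 0 ↔ α₀ = 0 ∧ α₁ = 0` in `ℤ_[7]` (the form is anisotropic: `v₇(x²)` is even,
  `v₇(7y²)` odd), so `jα := (α₀² + 7α₁²).valuation` is the valuation of a NON-ZERO element whenever `(α₀, α₁) ≠ 0`;
* §2 `exists_unit_mul_pow_valuation`, `pow_valuation_dvd` — the normal form `N = w·7^{v(N)}`, `w ∈ ℤ₇ˣ` (Mathlib's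
  `PadicInt.unitCoeff_spec`), replacing `Nat.factorization`/`natCast_toNat_normSeven` of the integer currency;
* §3 `pow_dvd_algebraMap_sub_algebraMap_mul` — `7^j ∣ α₀² + 7α₁² ⟹ π^j ∣ (algebraMap α₀ − algebraMap α₁·π)` in any
  commutative `ℤ_[7]`-algebra `R` with `7 = v·π²` (same induction as the integer kernel, `(7 : ℤ_[7])` prime);
* §4 `pow_dvd_constZ_mul_of_le`, `pow_dvd_constZ_of_le` — the D916 divisibility `π^(m₀ + 2jα) ∣ cZ·t′` from the integer
  inequality `m₀ + 2jα ≤ jα + (2e + 2k + a) + m′`, `cZ := (α₀ − α₁π)·7^e·(w·(7^k·(u·π^a)))` (the body of `KatoExpDatum.cZ`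
  with `algebraMap ℤ_[7] R` for the `ℤ`-casts), and `slack_iff` — the one-line arithmetic of hazard (H-a):
  with `jα = 2e + 2k + a_W − ι`, `jα ≤ 2e + 2k + a ↔ a_W ≤ a + ι`;
* §5 `sq_ne_neg_seven`, `reading_eq_zero_iff` — `−7` is not a square in `ℚ_[7]`, hence for every ring map
  `ι : ℚ_[7] →+* ℂ` and every `s ∈ ℂ` with `s² = −7` the reading `(a, b) ↦ ι a + ι b·s` of `ℚ₇ ⊗ K = ℚ₇ ⊕ ℚ₇√−7` is
  injective — so the complex identity (eZ′) determines the 7-adic pair `(α₀, α₁)`, and `α` is algebraic iff its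
  coordinates are.

HONEST LABEL: elementary algebra over `Mathlib`; no frame, datum, stub or skeleton is touched; nothing here is a
statement about Kato's objects; stmt-BirchSwinnertonDyer-19945 is OPEN (4 sorries, zp v17 ec08528542ba2d3f, pen's line of
record, untouched); K2ᶜ inhabitation NOT done; no summit statement is proved by this seat; BSD is claimed for no curve.

References: K. Kato, Astérisque 295 (2004), §15.8 (p. 257), Prop. 15.9 (pp. 258–259), (15.16.1) (p. 265) [Kato2004Asterisque];
tree `Additive/RamifiedSevenGenusKatoExpDatum.lean` :157–171 (the (eZ) fields), `Additive/RamifiedSevenPeriodPositionKernel.lean`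
§1; memo `StarValuePin_g79.md` REV 1.1 §8–§9.
-/

namespace Summit.BirchSwinnertonDyer.BirchSwinnertonDyer.Cruxes.EllipticUnitValueSevenOfGZK.EZConstantPadic

variable [Fact (Nat.Prime 7)]

/-! ## §1 Anisotropy of `x² + 7y²` over `ℤ₇` -/

/-- `7` is prime in `ℤ₇`. [folklore] -/
theorem prime_seven : Prime (7 : ℤ_[7]) := by
  simpa using (PadicInt.prime_p (p := 7))

/-- `7 ≠ 0` in `ℤ₇`. [folklore] -/
theorem seven_ne_zero : (7 : ℤ_[7]) ≠ 0 := prime_seven.ne_zero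

/-- `v(7·x) = 1 + v(x)` for `x ≠ 0`. [folklore] -/
theorem valuation_seven_mul {x : ℤ_[7]} (hx : x ≠ 0) : ((7 : ℤ_[7]) * x).valuation = 1 + x.valuation := by
  rw [PadicInt.valuation_mul seven_ne_zero hx]
  simpa using (PadicInt.valuation_p (p := 7))

/-- One descent step: a solution of `a² + 7b² = 0` is `7`·(a solution). [folklore] -/
theorem descent {a b : ℤ_[7]} (h : a ^ 2 + 7 * b ^ 2 = 0) :
    ∃ a' b' : ℤ_[7], a = 7 * a' ∧ b = 7 * b' ∧ a' ^ 2 + 7 * b' ^ 2 = 0 := by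
  have h7a2 : (7 : ℤ_[7]) ∣ a ^ 2 := ⟨-b ^ 2, by linear_combination h⟩
  obtain ⟨a', rfl⟩ := prime_seven.dvd_of_dvd_pow h7a2
  have h' : (7 : ℤ_[7]) * (7 * a' ^ 2 + b ^ 2) = 7 * 0 := by linear_combination h
  have h'' : 7 * a' ^ 2 + b ^ 2 = 0 := mul_left_cancel₀ seven_ne_zero h'
  have h7b2 : (7 : ℤ_[7]) ∣ b ^ 2 := ⟨-a' ^ 2, by linear_combination h''⟩
  obtain ⟨b', rfl⟩ := prime_seven.dvd_of_dvd_pow h7b2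
  refine ⟨a', b', rfl, rfl, ?_⟩
  have h3 : (7 : ℤ_[7]) * (a' ^ 2 + 7 * b' ^ 2) = 7 * 0 := by linear_combination h''
  exact mul_left_cancel₀ seven_ne_zero h3

/-- **`x² + 7y²` is anisotropic over `ℤ₇`**: `a² + 7b² = 0 ↔ a = 0 ∧ b = 0`. [folklore] -/
theorem normSeven_eq_zero_iff (a b : ℤ_[7]) : a ^ 2 + 7 * b ^ 2 = 0 ↔ a = 0 ∧ b = 0 := by
  constructor
  · intro h
    -- descent on the valuation of `a`; if `a = 0` then `7b² = 0` forces `b = 0`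
    suffices ha : a = 0 by
      subst ha
      have : (7 : ℤ_[7]) * b ^ 2 = 0 := by simpa using h
      rcases mul_eq_zero.mp this with h7 | hb
      · exact absurd h7 seven_ne_zero
      · exact ⟨rfl, pow_eq_zero_iff (n := 2) (by norm_num) |>.mp hb⟩
    by_contra ha
    -- strong induction on `n = v(a)` over all solutions with `a ≠ 0`
    have key : ∀ n : ℕ, ∀ a b : ℤ_[7], a ≠ 0 → a.valuation = n → a ^ 2 + 7 * b ^ 2 = 0 → False := by
      intro n
      induction n using Nat.strong_induction_on with
      | _ n ih =>
        intro a b ha hn h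
        obtain ⟨a', b', rfl, rfl, h'⟩ := descent h
        have ha' : a' ≠ 0 := by
          rintro rfl
          exact ha (by simp)
        have hv : (7 * a').valuation = 1 + a'.valuation := valuation_seven_mul ha'
        exact ih a'.valuation (by omega) a' b' ha' rfl h'
    exact key a.valuation a b ha rfl h
  · rintro ⟨rfl, rfl⟩
    simp

/-- `(α₀, α₁) ≠ 0 ⟹ α₀² + 7α₁² ≠ 0` in `ℤ₇` — so `jα := (α₀² + 7α₁²).valuation` is the valuation of a non-zero element.
[cite: Kato2004Asterisque, (15.16.1) (p. 265)] -/
theorem normSeven_ne_zero {α₀ α₁ : ℤ_[7]} (h : α₀ ≠ 0 ∨ α₁ ≠ 0) : α₀ ^ 2 + 7 * α₁ ^ 2 ≠ 0 := by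
  intro h0
  obtain ⟨h1, h2⟩ := (normSeven_eq_zero_iff α₀ α₁).mp h0
  rcases h with h | h
  · exact h h1
  · exact h h2

/-! ## §2 The normal form `N = w·7^{v(N)}` -/

/-- **Normal form**: a non-zero `x ∈ ℤ₇` is `w·7^{v(x)}` with `w` a unit (Mathlib `PadicInt.unitCoeff_spec`). [folklore] -/
theorem exists_unit_mul_pow_valuation {x : ℤ_[7]} (hx : x ≠ 0) :
    ∃ w : ℤ_[7]ˣ, x = (w : ℤ_[7]) * 7 ^ x.valuation :=
  ⟨PadicInt.unitCoeff hx, by simpa using PadicInt.unitCoeff_spec hx⟩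

/-- `7^{v(x)} ∣ x` — the replacement of `seven_pow_factorization_dvd_norm`. [folklore] -/
theorem pow_valuation_dvd {x : ℤ_[7]} (hx : x ≠ 0) : (7 : ℤ_[7]) ^ x.valuation ∣ x := by
  obtain ⟨w, hw⟩ := exists_unit_mul_pow_valuation hx
  exact ⟨w, by rw [mul_comm]; exact hw⟩

/-- `7^{jα} ∣ α₀² + 7α₁²` for `jα := (α₀² + 7α₁²).valuation`, `(α₀, α₁) ≠ 0` — the letter the re-typed `KatoExpDatum.jα` needs.
[cite: Kato2004Asterisque, (15.16.1) (p. 265)] -/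
theorem seven_pow_valuation_dvd_norm {α₀ α₁ : ℤ_[7]} (h : α₀ ≠ 0 ∨ α₁ ≠ 0) :
    (7 : ℤ_[7]) ^ (α₀ ^ 2 + 7 * α₁ ^ 2).valuation ∣ α₀ ^ 2 + 7 * α₁ ^ 2 :=
  pow_valuation_dvd (normSeven_ne_zero h)

/-! ## §3 The (F-b) kernel over a `ℤ₇`-algebra with `7 = v·π²` -/

section Kernel

variable {R : Type*} [CommRing R] [Algebra ℤ_[7] R]

/-- **`π^j ∣ α₀ − α₁π` whenever `7^j ∣ α₀² + 7α₁²` (`α₀, α₁ ∈ ℤ₇`)**, in any commutative `ℤ₇`-algebra with `7 = v·π²` —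
the 7-adic currency of `PeriodPosition.pow_dvd_intCast_sub_intCast_mul` (same induction on `j`).
[cite: Kato2004Asterisque, (15.16.1) (p. 265)] -/
theorem pow_dvd_algebraMap_sub_algebraMap_mul (π v : R) (h7 : (7 : R) = v * π ^ 2) :
    ∀ (j : ℕ) (α₀ α₁ : ℤ_[7]), (7 : ℤ_[7]) ^ j ∣ α₀ ^ 2 + 7 * α₁ ^ 2 →
      π ^ j ∣ (algebraMap ℤ_[7] R α₀ - algebraMap ℤ_[7] R α₁ * π) := by
  intro j
  induction j using Nat.strong_induction_on with
  | _ j ih =>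
    intro α₀ α₁ hdvd
    match j, ih, hdvd with
    | 0, _, _ => exact ⟨algebraMap ℤ_[7] R α₀ - algebraMap ℤ_[7] R α₁ * π, by ring⟩
    | 1, _, hdvd =>
      have h7N : (7 : ℤ_[7]) ∣ α₀ ^ 2 + 7 * α₁ ^ 2 := by simpa using hdvd
      have h7a : (7 : ℤ_[7]) ∣ α₀ ^ 2 := (dvd_add_left (dvd_mul_right (7 : ℤ_[7]) (α₁ ^ 2))).mp h7N
      obtain ⟨a, rfl⟩ := prime_seven.dvd_of_dvd_pow h7a
      refine ⟨v * π * algebraMap ℤ_[7] R a - algebraMap ℤ_[7] R α₁, ?_⟩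
      rw [map_mul, map_ofNat, h7]
      ring
    | j + 2, ih, hdvd =>
      have h7N : (7 : ℤ_[7]) ∣ α₀ ^ 2 + 7 * α₁ ^ 2 :=
        (dvd_pow_self (7 : ℤ_[7]) (by omega : j + 2 ≠ 0)).trans hdvd
      have h7a : (7 : ℤ_[7]) ∣ α₀ ^ 2 := (dvd_add_left (dvd_mul_right (7 : ℤ_[7]) (α₁ ^ 2))).mp h7N
      obtain ⟨a, rfl⟩ := prime_seven.dvd_of_dvd_pow h7a
      have h49 : (7 : ℤ_[7]) ^ 2 ∣ (7 * a) ^ 2 + 7 * α₁ ^ 2 :=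
        (pow_dvd_pow (7 : ℤ_[7]) (by omega : 2 ≤ j + 2)).trans hdvd
      have h49' : (7 : ℤ_[7]) * 7 ∣ 7 * α₁ ^ 2 := by
        have h1 : (7 : ℤ_[7]) ^ 2 ∣ (7 * a) ^ 2 := ⟨a ^ 2, by ring⟩
        have h2 := (dvd_add_right h1).mp h49
        simpa [pow_two] using h2
      have h7b2 : (7 : ℤ_[7]) ∣ α₁ ^ 2 := (mul_dvd_mul_iff_left seven_ne_zero).mp h49'
      obtain ⟨b, rfl⟩ := prime_seven.dvd_of_dvd_pow h7b2
      have hj : (7 : ℤ_[7]) ^ j ∣ a ^ 2 + 7 * b ^ 2 := by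
        have h1 : (7 : ℤ_[7]) ^ (j + 2) = 7 ^ 2 * 7 ^ j := by ring
        have h2 : (7 * a) ^ 2 + 7 * (7 * b) ^ 2 = (7 : ℤ_[7]) ^ 2 * (a ^ 2 + 7 * b ^ 2) := by ring
        rw [h1, h2] at hdvd
        exact (mul_dvd_mul_iff_left (pow_ne_zero 2 seven_ne_zero)).mp hdvd
      obtain ⟨c, hc⟩ := ih j (by omega) a b hj
      refine ⟨v * c, ?_⟩
      rw [map_mul, map_mul, map_ofNat]
      have h3 : (7 : R) * algebraMap ℤ_[7] R a - 7 * algebraMap ℤ_[7] R b * π =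
          7 * (algebraMap ℤ_[7] R a - algebraMap ℤ_[7] R b * π) := by ring
      rw [h3, hc, h7]
      ring

/-! ## §4 The D916 divisibility in the 7-adic currency, and the slack arithmetic of (H-a) -/

/-- **The D916 divisibility input from an integer inequality (general `t`-gauge), 7-adic currency.**  With
`jα := (α₀² + 7α₁²).valuation`, `cZ := (α₀ − α₁π)·7^e·(w·(7^k·(u·π^a)))` and `t′ = w′·π^{m′}`:
`m₀ + 2jα ≤ jα + (2e + 2k + a) + m′ ⟹ π^(m₀ + 2jα) ∣ cZ·t′`.  No unit hypothesis on `v, w, u, w′`.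
[cite: Kato2004Asterisque, (15.16.1) (p. 265)] -/
theorem pow_dvd_constZ_mul_of_le (π v : R) (h7 : (7 : R) = v * π ^ 2) (α₀ α₁ : ℤ_[7]) (hα : α₀ ≠ 0 ∨ α₁ ≠ 0)
    (e k a m₀ m' : ℕ) (w u w' : R)
    (hle : m₀ + 2 * (α₀ ^ 2 + 7 * α₁ ^ 2).valuation ≤
      (α₀ ^ 2 + 7 * α₁ ^ 2).valuation + (2 * e + 2 * k + a) + m') :
    π ^ (m₀ + 2 * (α₀ ^ 2 + 7 * α₁ ^ 2).valuation) ∣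
      (((algebraMap ℤ_[7] R α₀ - algebraMap ℤ_[7] R α₁ * π) * (7 : R) ^ e) *
          (w * ((7 : R) ^ k * (u * π ^ a)))) * (w' * π ^ m') := by
  set j : ℕ := (α₀ ^ 2 + 7 * α₁ ^ 2).valuation with hj
  obtain ⟨c, hc⟩ :=
    pow_dvd_algebraMap_sub_algebraMap_mul π v h7 j α₀ α₁ (seven_pow_valuation_dvd_norm hα)
  have hpow : π ^ (m₀ + 2 * j) ∣ π ^ (j + (2 * e + 2 * k + a) + m') := pow_dvd_pow π hle
  have hshape : (((algebraMap ℤ_[7] R α₀ - algebraMap ℤ_[7] R α₁ * π) * (7 : R) ^ e) *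
        (w * ((7 : R) ^ k * (u * π ^ a)))) * (w' * π ^ m') =
      π ^ (j + (2 * e + 2 * k + a) + m') * (c * v ^ e * w * v ^ k * u * w') := by
    rw [hc, h7]
    ring
  rw [hshape]
  exact hpow.mul_right _

/-- **The `t = t′ = 1`, `m₀ = 0` gauge**: `jα ≤ 2e + 2k + a ⟹ π^(2jα) ∣ cZ` — the hypothesis is `PeriodPositionField` in the
7-adic currency. [cite: Kato2004Asterisque, (15.16.1) (p. 265)] -/
theorem pow_dvd_constZ_of_le (π v : R) (h7 : (7 : R) = v * π ^ 2) (α₀ α₁ : ℤ_[7]) (hα : α₀ ≠ 0 ∨ α₁ ≠ 0)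
    (e k a : ℕ) (w u : R) (hle : (α₀ ^ 2 + 7 * α₁ ^ 2).valuation ≤ 2 * e + 2 * k + a) :
    π ^ (2 * (α₀ ^ 2 + 7 * α₁ ^ 2).valuation) ∣
      ((algebraMap ℤ_[7] R α₀ - algebraMap ℤ_[7] R α₁ * π) * (7 : R) ^ e) *
        (w * ((7 : R) ^ k * (u * π ^ a))) := by
  have h := pow_dvd_constZ_mul_of_le π v h7 α₀ α₁ hα e k a 0 0 w u 1 (by omega)
  simpa using h

end Kernel

omit [Fact (Nat.Prime 7)] in
/-- **The slack arithmetic of hazard (H-a)** (`StarValuePin_g79.md` REV 1.1 §8.1): if the datum's exponent obeys the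
pre-registered law `jα = 2e + 2k + a_W − ι` (`a_W` the member type, `ι` the `O_𝔭`-index of the column's vector, `ι ≤ … `
so that the subtraction is genuine), then the (S-★) inequality `jα ≤ 2e + 2k + a` holds iff `a_W ≤ a + ι`; in particular
under the GIVEN-★ exponent `a = 0` and a 𝔭-primitive column `ι = 0` it holds iff `a_W = 0`.
[cite: Kato2004Asterisque, (15.16.1) (p. 265)] -/
theorem slack_iff (jα e k a aW ι : ℕ) (hι : ι ≤ 2 * e + 2 * k + aW) (hlaw : jα = 2 * e + 2 * k + aW - ι) :
    jα ≤ 2 * e + 2 * k + a ↔ aW ≤ a + ι := by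
  omega

omit [Fact (Nat.Prime 7)] in
/-- The GIVEN-★ / 𝔭-primitive instance of `slack_iff`: `a = 0`, `ι = 0` ⟹ ((S-★) ↔ `a_W = 0`).
[cite: Kato2004Asterisque, (15.16.1) (p. 265)] -/
theorem slack_iff_given_primitive (jα e k aW : ℕ) (hlaw : jα = 2 * e + 2 * k + aW) :
    jα ≤ 2 * e + 2 * k + 0 ↔ aW = 0 := by
  omega

/-! ## §5 `−7` is not a square in `ℚ₇`; the `(ι₇ ⊗ ιC)`-reading of `ℚ₇ ⊕ ℚ₇√−7` into `ℂ` is injective -/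

/-- `v(−1) = 0` in `ℚ₇`. [folklore] -/
theorem valuation_neg_one : (-1 : ℚ_[7]).valuation = 0 := by
  have h : (-1 : ℚ_[7]) * (-1) = 1 := by ring
  have hne : (-1 : ℚ_[7]) ≠ 0 := by norm_num
  have := Padic.valuation_mul hne hne
  rw [h, Padic.valuation_one] at this
  omega

/-- **`−7` is not a square in `ℚ₇`** (`v(x²) = 2v(x)` is even, `v(−7) = 1`). [folklore] -/
theorem sq_ne_neg_seven (x : ℚ_[7]) : x ^ 2 ≠ -7 := by
  intro hx
  have hx0 : x ≠ 0 := by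
    rintro rfl
    norm_num at hx
  have h2 : (x * x).valuation = x.valuation + x.valuation := Padic.valuation_mul hx0 hx0
  have h7 : ((-1 : ℚ_[7]) * 7).valuation = (-1 : ℚ_[7]).valuation + (7 : ℚ_[7]).valuation :=
    Padic.valuation_mul (by norm_num) (by exact_mod_cast (show (7 : ℕ) ≠ 0 by norm_num))
  have hp : (7 : ℚ_[7]).valuation = 1 := by exact_mod_cast (Padic.valuation_p (p := 7))
  have hxx : x * x = (-1 : ℚ_[7]) * 7 := by rw [← pow_two, hx]; ring
  rw [hxx, h7, valuation_neg_one, hp] at h2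
  omega

/-- **Injectivity of the reading**: for a ring map `ι : ℚ₇ → ℂ` and `s ∈ ℂ` with `s² = −7`,
`ι a + ι b·s = 0 ↔ a = 0 ∧ b = 0` — `{1, s}` is linearly independent over `ι(ℚ₇)`, because `s ∈ ι(ℚ₇)` would make `−7` a
square in `ℚ₇`.  Consequence for (eZ′): the complex value law determines the 7-adic pair `(α₀, α₁)`.
[cite: Kato2004Asterisque, Prop. 15.9 (pp. 258–259)] -/
theorem reading_eq_zero_iff (ι : ℚ_[7] →+* ℂ) (s : ℂ) (hs : s ^ 2 = -7) (a b : ℚ_[7]) :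
    ι a + ι b * s = 0 ↔ a = 0 ∧ b = 0 := by
  constructor
  · intro h
    by_cases hb : b = 0
    · subst hb
      have ha : ι a = 0 := by simpa using h
      exact ⟨(map_eq_zero_iff ι ι.injective).mp ha, rfl⟩
    · exfalso
      have hιb : ι b ≠ 0 := (map_ne_zero_iff ι ι.injective).mpr hb
      have hs' : s = ι (-a / b) := by
        rw [map_div₀, map_neg]
        field_simp
        linear_combination h
      have h7 : ι ((-a / b) ^ 2) = ι (-7) := by
        rw [map_pow, ← hs', hs, map_neg, map_ofNat]
      exact sq_ne_neg_seven (-a / b) (ι.injective h7)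
  · rintro ⟨rfl, rfl⟩
    simp

/-- Equality of readings ⟺ equality of 7-adic coordinates. [cite: Kato2004Asterisque, Prop. 15.9 (pp. 258–259)] -/
theorem reading_eq_reading_iff (ι : ℚ_[7] →+* ℂ) (s : ℂ) (hs : s ^ 2 = -7) (a b a' b' : ℚ_[7]) :
    ι a + ι b * s = ι a' + ι b' * s ↔ a = a' ∧ b = b' := by
  have h := reading_eq_zero_iff ι s hs (a - a') (b - b')
  rw [map_sub, map_sub, sub_eq_zero, sub_eq_zero] at h
  rw [← h]
  constructor
  · intro heq
    linear_combination heq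
  · intro heq
    linear_combination heq

end Summit.BirchSwinnertonDyer.BirchSwinnertonDyer.Cruxes.EllipticUnitValueSevenOfGZK.EZConstantPadic
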